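import Mathlib.RingTheory.AdjoinRoot
import Mathlib.FieldTheory.KummerPolynomial
import Mathlib.FieldTheory.PurelyInseparable.Basic
import Mathlib.Algebra.CharP.Lemmas
import Mathlib.Algebra.CharP.Algebra
import Summits.ResolutionOfSingularities.ResolutionOfSingularities.Theses.RadicialJung
import Summits.ResolutionOfSingularities.ResolutionOfSingularities.Theorems.RadicialJungCleanModelsReduction
import HarnessLib

/-!
# Stub `stub_principalizationDimLEOne` (crux stmt-ResolutionOfSingularities-15917, `CleanModels`)

Route `ResolutionOfSingularities/RadicialJung`, crux item `CleanModels`, line `Sketch` (rev 6.2):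
the calibration in dimension `≤ 1` of the `L`-free loosely clean principalization at closed
points (no blow-up needed, `V = W`).

For a regular integral separated `W` of finite type over a field `k` of characteristic `p` with
`dim W ≤ 1` and `g₀ ∈ K(W) ∖ K(W)^p`, there is a proper birational regular model (in fact `W`
itself) on which, at every closed point, some non-trivial representative `Σ_{j<p} c_j^p g₀^j` of
the `K(W)^p`-line of `g₀` is loosely clean.

Proof. `L := K(W)[T]/(T^p - g₀)` is a field (`X^p - g₀` is irreducible since `g₀ ∉ K(W)^p`,
`X_pow_sub_C_irreducible_of_prime`), purely inseparable of degree `p` over `K(W)`: every `y ∈ L`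
reads `y = Σ_{j<p} c_j θ^j` (`θ` the class of `T`, reduction modulo the monic `T^p - g₀`), whence
`y^p = Σ c_j^p g₀^j ∈ K(W)` by Frobenius, and `y ∈ K(W)` if `c_j = 0` for all `j ≠ 0`. The landed
calibration `cleanModels_dim_le_one` applied to `L` gives the model with, at every point, some
`y ∈ L ∖ K(W)`, `y^p = g`, `π^* g` exactly clean; then `g = Σ c_j^p g₀^j` by injectivity of
`K(W) → L`, and exact forms are loose forms with unit factor `1`.
-/

noncomputable section

set_option linter.dupNamespace false -- mandated namespace of this single-conjunct summit

open CategoryTheory AlgebraicGeometry TopologicalSpace IsLocalRing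
open Literature.AlgebraicGeometry.Resolution Literature.AlgebraicGeometry.Motives

namespace Summit.ResolutionOfSingularities.ResolutionOfSingularities.Theorems.RadicialJung.CleanModels

universe u

open Polynomial in
/-- **The radicial extension `K(g₀^{1/p})`.** For `g₀ ∈ K ∖ K^p` (`char K = p` prime) there is a
field `L ⊇ K` (namely `K[T]/(T^p - g₀)`), purely inseparable of degree `p` over `K`, in which every
`y` has `y^p = Σ_{j<p} c_j^p g₀^j` for some `c : Fin p → K` with `c_j ≠ 0` for some `j ≠ 0`
unless `y ∈ K` (write `y = Σ c_j θ^j`, `θ^p = g₀`, and apply Frobenius). -/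
theorem exists_purelyInseparable_of_forall_pow_ne {K : Type u} [Field K] (p : ℕ) (hp : p.Prime)
    [CharP K p] (g₀ : K) (hg₀ : ∀ c : K, c ^ p ≠ g₀) :
    ∃ (L : Type u) (_ : Field L) (_ : Algebra K L),
      IsPurelyInseparable K L ∧ Module.finrank K L = p ∧
      ∀ y : L, ∃ c : Fin p → K,
        algebraMap K L (∑ j : Fin p, c j ^ p * g₀ ^ (j : ℕ)) = y ^ p ∧
        (y ∉ Set.range (algebraMap K L) → ∃ j : Fin p, (j : ℕ) ≠ 0 ∧ c j ≠ 0) := by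
  haveI := Fact.mk hp
  obtain ⟨P, hPdef⟩ : ∃ P : K[X], P = X ^ p - C g₀ := ⟨_, rfl⟩
  have hirr : Irreducible P := by rw [hPdef]; exact X_pow_sub_C_irreducible_of_prime hp hg₀
  haveI := Fact.mk hirr
  have hmonic : P.Monic := by rw [hPdef]; exact monic_X_pow_sub_C g₀ hp.ne_zero
  have hP1 : P ≠ 1 := hirr.ne_one
  have hdegP : P.natDegree = p := by rw [hPdef]; exact natDegree_X_pow_sub_C
  haveI : CharP (AdjoinRoot P) p :=
    charP_of_injective_algebraMap (algebraMap K (AdjoinRoot P)).injective p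
  -- `θ ^ p = g₀`
  have hθ : AdjoinRoot.root P ^ p = algebraMap K (AdjoinRoot P) g₀ := by
    have h : aeval (AdjoinRoot.root P) (X ^ p - C g₀ : K[X]) = 0 := by
      rw [← hPdef, AdjoinRoot.aeval_eq, AdjoinRoot.mk_self]
    rwa [map_sub, aeval_X_pow, aeval_C, sub_eq_zero] at h
  -- every element is a `K`-combination of `1, θ, …, θ^(p-1)` (reduction modulo the monic `P`)
  have hrep : ∀ y : AdjoinRoot P, ∃ c : Fin p → K,
      y = ∑ j : Fin p, algebraMap K (AdjoinRoot P) (c j) * AdjoinRoot.root P ^ (j : ℕ) := by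
    intro y
    obtain ⟨q, rfl⟩ := AdjoinRoot.mk_surjective y
    refine ⟨fun j => (q %ₘ P).coeff j, ?_⟩
    have hmk : AdjoinRoot.mk P q = AdjoinRoot.mk P (q %ₘ P) := by
      rw [AdjoinRoot.mk_eq_mk, dvd_sub_comm]
      exact dvd_modByMonic_sub q P
    have hlt : (q %ₘ P).natDegree < p := hdegP ▸ natDegree_modByMonic_lt q hmonic hP1
    rw [hmk, ← AdjoinRoot.aeval_eq, aeval_eq_sum_range' hlt (AdjoinRoot.root P),
      ← Fin.sum_univ_eq_sum_range]
    simp only [Algebra.smul_def]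
  -- Frobenius: `(Σ c_j θ^j)^p = Σ c_j^p g₀^j`
  have hpow : ∀ c : Fin p → K,
      (∑ j : Fin p, algebraMap K (AdjoinRoot P) (c j) * AdjoinRoot.root P ^ (j : ℕ)) ^ p =
        algebraMap K (AdjoinRoot P) (∑ j : Fin p, c j ^ p * g₀ ^ (j : ℕ)) := by
    intro c
    rw [sum_pow_char, map_sum]
    refine Finset.sum_congr rfl fun j _ => ?_
    rw [mul_pow, ← map_pow, ← pow_mul, mul_comm (j : ℕ) p, pow_mul, hθ, ← map_pow, ← map_mul]
  refine ⟨AdjoinRoot P, inferInstance, inferInstance, ?_, ?_, fun y => ?_⟩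
  · -- purely inseparable: `y ^ p ∈ K`
    rw [isPurelyInseparable_iff_pow_mem K p]
    intro y
    obtain ⟨c, rfl⟩ := hrep y
    exact ⟨1, RingHom.mem_range.mpr ⟨∑ j : Fin p, c j ^ p * g₀ ^ (j : ℕ), by rw [pow_one, hpow]⟩⟩
  · -- degree `p`
    rw [(AdjoinRoot.powerBasis hmonic.ne_zero).finrank, AdjoinRoot.powerBasis_dim, hdegP]
  · obtain ⟨c, rfl⟩ := hrep y
    refine ⟨c, (hpow c).symm, fun hy => ?_⟩
    by_contra hne
    push Not at hne
    apply hy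
    refine ⟨c ⟨0, hp.pos⟩, ?_⟩
    rw [Finset.sum_eq_single ⟨0, hp.pos⟩]
    · simp
    · intro j _ hj
      rw [hne j (fun h0 => hj (Fin.ext h0)), map_zero, zero_mul]
    · intro h; exact absurd (Finset.mem_univ _) h

/-- **Loosely clean principalization at closed points in dimension `≤ 1`, `L`-free** (calibration,
`V = W`). For a regular integral separated `W` of finite type over a field `k` of characteristic
`p` with `dim W ≤ 1` and `g₀ ∈ K(W) ∖ K(W)^p`, there is a proper birational regular model on
which, at every closed point, some non-trivial representative `Σ_{j<p} c_j^p g₀^j` is loosely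
clean: the landed `cleanModels_dim_le_one` applied to `L := K(W)[T]/(T^p - g₀)` (a field, purely
inseparable of degree `p`, `exists_purelyInseparable_of_forall_pow_ne`), reading `y = Σ c_j θ^j`,
`y^p = Σ c_j^p g₀^j`; exact forms are loose forms with unit factor `1`. -/
theorem stub_principalizationDimLEOne (p : ℕ) (hp : p.Prime) (k : Type) [Field k] [CharP k p]
    (W : Scheme.{0}) [IsIntegral W] (f : W ⟶ Spec (.of k)) [IsSeparated f]
    [LocallyOfFiniteType f] [QuasiCompact f] (hW : Scheme.IsRegular W) (g₀ : W.functionField)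
    (hg₀ : ∀ c : W.functionField, c ^ p ≠ g₀) (hdim : topologicalKrullDim W ≤ 1) :
    ∃ (V : Scheme.{0}) (π : V ⟶ W) (_ : IsIntegral V) (_ : IsDominant π),
      IsProper π ∧ IsBirational π ∧ Scheme.IsRegular V ∧
      ∀ v : V, IsClosed ({v} : Set V) →
        ∃ c : Fin p → W.functionField, (∃ j : Fin p, (j : ℕ) ≠ 0 ∧ c j ≠ 0) ∧
        ((∃ (d m : ℕ) (hmd : m ≤ d) (t : Fin d → V.presheaf.stalk v) (a : Fin m → ℕ)
            (u : V.presheaf.stalk v), IsUnit u ∧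
            Ideal.span (Set.range t) = maximalIdeal (V.presheaf.stalk v) ∧
            ringKrullDim (V.presheaf.stalk v) = (d : WithBot ℕ∞) ∧ 0 < m ∧ (∀ i, ¬ p ∣ a i) ∧
            RatFn.functionFieldMap π (∑ j : Fin p, c j ^ p * g₀ ^ (j : ℕ)) =
              algebraMap (V.presheaf.stalk v) V.functionField
                (u * ∏ i : Fin m, t (Fin.castLE hmd i) ^ (a i))) ∨
          (∃ u : V.presheaf.stalk v, IsUnit u ∧
            RatFn.functionFieldMap π (∑ j : Fin p, c j ^ p * g₀ ^ (j : ℕ)) =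
              algebraMap (V.presheaf.stalk v) V.functionField u ∧
            ∀ c' : V.presheaf.stalk v, u - c' ^ p ∉ maximalIdeal (V.presheaf.stalk v)) ∨
          (∃ s c' : V.presheaf.stalk v,
            RatFn.functionFieldMap π (∑ j : Fin p, c j ^ p * g₀ ^ (j : ℕ)) =
              algebraMap (V.presheaf.stalk v) V.functionField s ∧
            s - c' ^ p ∈ maximalIdeal (V.presheaf.stalk v) ∧
            s - c' ^ p ∉ maximalIdeal (V.presheaf.stalk v) ^ 2)) := by
  haveI : CharP W.functionField p := charP_stalk W f _
  obtain ⟨L, _instF, _instA, hPI, hdeg, hrep⟩ :=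
    exists_purelyInseparable_of_forall_pow_ne (K := W.functionField) p hp g₀ hg₀
  obtain ⟨V, π, hVint, hπdom, hπprop, hπbir, hVreg, hall⟩ :=
    cleanModels_dim_le_one p hp k W f L inferInstance inferInstance inferInstance hW hPI hdeg hdim
  refine ⟨V, π, hVint, hπdom, hπprop, hπbir, hVreg, fun v _ => ?_⟩
  obtain ⟨y, g, hy, hyg, hexact⟩ := hall v
  obtain ⟨c, hc, hnt⟩ := hrep y
  have hg : g = ∑ j : Fin p, c j ^ p * g₀ ^ (j : ℕ) :=
    (algebraMap W.functionField L).injective (hyg.trans hc.symm)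
  refine ⟨c, hnt hy, ?_⟩
  rw [← hg]
  rcases hexact with ⟨d, m, hmd, t, a, ht, hd, hm, ha, hg'⟩ | ⟨u₀, hu₀, hg', hcase⟩
  · refine Or.inl ⟨d, m, hmd, t, a, 1, isUnit_one, ht, hd, hm, ha, ?_⟩
    rw [hg', one_mul, map_prod]
    simp only [map_pow]
  · rcases hcase with hno | ⟨c', hc₁, hc₂⟩
    · exact Or.inr (Or.inl ⟨u₀, hu₀, hg', hno⟩)
    · exact Or.inr (Or.inr ⟨u₀, c', hg', hc₁, hc₂⟩)

end Summit.ResolutionOfSingularities.ResolutionOfSingularities.Theorems.RadicialJung.CleanModels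

end
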